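import Summits.Ventures.Crystal3D.Theorems.StickyWulffConstantGenericWallFloorNonSaturation
import HarnessLib

/-!
# Non-saturation at coincidence sites, part 1: the reduction to `4 ≤ e₁, e₂`, `e₁ + e₂ ≤ 12`

HONEST FRAMING. Part of the venture `Summits/Ventures/Crystal3D` (cell `crystal3d-full`), helper
`--supports` the crux `GenericWallFloor` (stmt-Ventures-19480, `route-Ventures-StickyWulffConstant`),
REGISTERED line `WallLedgerG`, stub `stub_twoSlabAdhesion`, rigid-bicrystal rung, module M7
(non-saturation of TOP sites that are COINCIDENCE sites `p ∈ Λ₁ ∩ Λ₂`; so far a certified computation,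
M7-CERT kit j281432 / j281488).  Rung credit only; nothing here is the crux, and this file does NOT
prove M7 — it shrinks it.

* `card_foreign_add_one_le_card_empty_of_le_three` — the vacancy-atom half of
  `card_foreign_add_one_le_card_empty` needs neither L3′ nor `p ∉ Λ₂`: for ANY ball `p ∈ Λ₁` of a
  `1`-separated `X` whose foreign neighbours lie on `Λ₂` (pair non-co-axial), `1 ≤ e(p) ≤ 3` empty slots
  force `#foreign + 1 ≤ e(p)`.
* `four_le_card_empty_of_saturated_coincidence_top` — consequently a SATURATED (`deg = 12`) coincidence
  ball `p ∈ Λ₁ ∩ Λ₂` of a rigid bicrystal (all neighbours on `Λ₁ ∪ Λ₂`) which is a TOP for `Λ₁`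
  (slot `p + A₁u` empty, slot `p − A₁u` occupied) has at least FOUR empty `Λ₁`-slots AND at least four
  empty `Λ₂`-slots, and `e₁ + e₂ ≤ 12`: the mixed kissing dozens a structural proof / kernel port of M7
  must exclude are exactly those with `4 ≤ #own, #foreign ≤ 8` around a shared site.
WHAT THIS IS NOT: M7 itself; the rung; the stub; rung F-C1 not moved.
-/

noncomputable section

namespace Summit.Ventures.Crystal3D.Theorems

open Summit.Ventures.Crystal3D Finset
open Literature.MathematicalPhysics.StatisticalMechanics (barlowPos barlowStacking fccStacking
  constHagg IsHaggSeq)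
open scoped InnerProductSpace

open scoped Classical in
/-- **Up to three vacancies: `#foreign + 1 ≤ #empty` at ANY lattice ball** (coincidence sites
included).  `Λ₁, Λ₂` not co-axial, `X` `1`-separated, `p ∈ Λ₁` with foreign neighbours on `Λ₂` and
`1 ≤ e(p) ≤ 3`.  (Cases `e = 1, 2, 3` of `card_foreign_add_one_le_card_empty`; no L3′ needed.) -/
theorem card_foreign_add_one_le_card_empty_of_le_three
    (A₁ A₂ : EuclideanSpace ℝ (Fin 3) ≃ₗᵢ[ℝ] EuclideanSpace ℝ (Fin 3))
    (t₁ t₂ p : EuclideanSpace ℝ (Fin 3)) (X : Finset (EuclideanSpace ℝ (Fin 3)))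
    (hnc : ¬ ∃ (L : EuclideanSpace ℝ (Fin 3) ≃ₗᵢ[ℝ] EuclideanSpace ℝ (Fin 3))
        (s₁ s₂ : EuclideanSpace ℝ (Fin 3)) (σ σ' : ℤ → ℤ), IsHaggSeq σ ∧ IsHaggSeq σ' ∧
        (fun x => A₁ x + t₁) '' fccStacking 1 (Real.sqrt (2 / 3)) ⊆
          (fun x => L x + s₁) '' barlowStacking 1 (Real.sqrt (2 / 3)) σ ∧
        (fun x => A₂ x + t₂) '' fccStacking 1 (Real.sqrt (2 / 3)) ⊆
          (fun x => L x + s₂) '' barlowStacking 1 (Real.sqrt (2 / 3)) σ')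
    (hp₁ : p ∈ (fun x => A₁ x + t₁) '' fccStacking 1 (Real.sqrt (2 / 3)))
    (hsep : ∀ x ∈ X, ∀ y ∈ X, x ≠ y → 1 ≤ dist x y)
    (hfor : ∀ q ∈ X, dist p q = 1 → q ∉ (fun x => A₁ x + t₁) '' fccStacking 1 (Real.sqrt (2 / 3)) →
      q ∈ (fun x => A₂ x + t₂) '' fccStacking 1 (Real.sqrt (2 / 3)))
    (he : 1 ≤ (fccSlots.filter fun w => p + A₁ w ∉ X).card)
    (he3 : (fccSlots.filter fun w => p + A₁ w ∉ X).card ≤ 3) :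
    (X.filter fun q => dist p q = 1 ∧
        q ∉ (fun x => A₁ x + t₁) '' fccStacking 1 (Real.sqrt (2 / 3))).card + 1 ≤
      (fccSlots.filter fun w => p + A₁ w ∉ X).card := by
  classical
  set e := (fccSlots.filter fun w => p + A₁ w ∉ X).card with he_def
  set F := X.filter fun q => dist p q = 1 ∧
    q ∉ (fun x => A₁ x + t₁) '' fccStacking 1 (Real.sqrt (2 / 3)) with hF_def
  by_cases h1 : e = 1
  · have hF0 : F.card = 0 := by
      rw [Finset.card_eq_zero, Finset.eq_empty_iff_forall_notMem]
      intro q hq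
      obtain ⟨hqX, hpq, hqΛ⟩ := mem_filter.1 hq
      have h2 := two_le_card_empty_slots_of_foreign A₁ t₁ p q X hp₁ hqΛ hpq hqX hsep
      omega
    omega
  by_cases h2 : e = 2
  · have hF1 : F.card ≤ 1 := card_foreign_le_one_of_card_empty_eq_two A₁ t₁ p X hp₁ hsep h2
    omega
  have h3 : e = 3 := by omega
  by_contra hlt
  have hc : 3 ≤ F.card := by omega
  exact hnc (coaxial_of_card_empty_eq_three A₁ A₂ t₁ t₂ p X hp₁ hsep hfor h3 hc)

open scoped Classical in
/-- **Reduction of M7.**  Let `Λ₁, Λ₂` be non-co-axial, `X` `1`-separated with every neighbour of `p`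
on `Λ₁ ∪ Λ₂`, and `p ∈ Λ₁ ∩ Λ₂` a COINCIDENCE ball which is a top for `Λ₁` (`p + A₁u ∉ X`,
`p − A₁u ∈ X` for a slot `u`).  If `p` is saturated (`12` neighbours) then it has at least four empty
`Λ₁`-slots, at least four empty `Λ₂`-slots, and `e₁ + e₂ ≤ 12`. -/
theorem four_le_card_empty_of_saturated_coincidence_top
    (A₁ A₂ : EuclideanSpace ℝ (Fin 3) ≃ₗᵢ[ℝ] EuclideanSpace ℝ (Fin 3))
    (t₁ t₂ p u : EuclideanSpace ℝ (Fin 3)) (X : Finset (EuclideanSpace ℝ (Fin 3)))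
    (hnc : ¬ ∃ (L : EuclideanSpace ℝ (Fin 3) ≃ₗᵢ[ℝ] EuclideanSpace ℝ (Fin 3))
        (s₁ s₂ : EuclideanSpace ℝ (Fin 3)) (σ σ' : ℤ → ℤ), IsHaggSeq σ ∧ IsHaggSeq σ' ∧
        (fun x => A₁ x + t₁) '' fccStacking 1 (Real.sqrt (2 / 3)) ⊆
          (fun x => L x + s₁) '' barlowStacking 1 (Real.sqrt (2 / 3)) σ ∧
        (fun x => A₂ x + t₂) '' fccStacking 1 (Real.sqrt (2 / 3)) ⊆
          (fun x => L x + s₂) '' barlowStacking 1 (Real.sqrt (2 / 3)) σ')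
    (hp₁ : p ∈ (fun x => A₁ x + t₁) '' fccStacking 1 (Real.sqrt (2 / 3)))
    (hp₂ : p ∈ (fun x => A₂ x + t₂) '' fccStacking 1 (Real.sqrt (2 / 3)))
    (hsep : ∀ x ∈ X, ∀ y ∈ X, x ≠ y → 1 ≤ dist x y)
    (hX : ∀ q ∈ X, dist p q = 1 → q ∈ (fun x => A₁ x + t₁) '' fccStacking 1 (Real.sqrt (2 / 3)) ∨
      q ∈ (fun x => A₂ x + t₂) '' fccStacking 1 (Real.sqrt (2 / 3)))
    (hu : u ∈ fccSlots) (hup : p + A₁ u ∉ X) (hdown : p + A₁ (-u) ∈ X)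
    (hdeg : (X.filter fun q => dist p q = 1).card = 12) :
    4 ≤ (fccSlots.filter fun w => p + A₁ w ∉ X).card ∧
      4 ≤ (fccSlots.filter fun w => p + A₂ w ∉ X).card ∧
      (fccSlots.filter fun w => p + A₁ w ∉ X).card + (fccSlots.filter fun w => p + A₂ w ∉ X).card ≤ 12 := by
  classical
  set Λ₁ : Set (EuclideanSpace ℝ (Fin 3)) := (fun x => A₁ x + t₁) '' fccStacking 1 (Real.sqrt (2 / 3))
    with hΛ₁
  set Λ₂ : Set (EuclideanSpace ℝ (Fin 3)) := (fun x => A₂ x + t₂) '' fccStacking 1 (Real.sqrt (2 / 3))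
    with hΛ₂
  set e₁ := (fccSlots.filter fun w => p + A₁ w ∉ X).card with he₁
  set e₂ := (fccSlots.filter fun w => p + A₂ w ∉ X).card with he₂
  set c₁ := (X.filter fun q => dist p q = 1 ∧ q ∉ Λ₁).card with hc₁
  set c₂ := (X.filter fun q => dist p q = 1 ∧ q ∉ Λ₂).card with hc₂
  -- the symmetric (roles swapped) non-co-axiality
  have hnc' : ¬ ∃ (L : EuclideanSpace ℝ (Fin 3) ≃ₗᵢ[ℝ] EuclideanSpace ℝ (Fin 3))
      (s₁ s₂ : EuclideanSpace ℝ (Fin 3)) (σ σ' : ℤ → ℤ), IsHaggSeq σ ∧ IsHaggSeq σ' ∧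
      Λ₂ ⊆ (fun x => L x + s₁) '' barlowStacking 1 (Real.sqrt (2 / 3)) σ ∧
      Λ₁ ⊆ (fun x => L x + s₂) '' barlowStacking 1 (Real.sqrt (2 / 3)) σ' := by
    rintro ⟨L, s₁, s₂, σ, σ', hσ, hσ', h2, h1⟩
    exact hnc ⟨L, s₂, s₁, σ', σ, hσ', hσ, h1, h2⟩
  have hfor₁ : ∀ q ∈ X, dist p q = 1 → q ∉ Λ₁ → q ∈ Λ₂ := fun q hq hd hn =>
    (hX q hq hd).resolve_left hn
  have hfor₂ : ∀ q ∈ X, dist p q = 1 → q ∉ Λ₂ → q ∈ Λ₁ := fun q hq hd hn =>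
    (hX q hq hd).resolve_right hn
  -- ledger identities at `p` for both lattices
  have hL₁ : (12 : ℤ) - ((X.filter fun q => dist p q = 1).card : ℤ) = (e₁ : ℤ) - (c₁ : ℤ) :=
    twelve_sub_degree_eq A₁ t₁ p X hp₁
  have hL₂ : (12 : ℤ) - ((X.filter fun q => dist p q = 1).card : ℤ) = (e₂ : ℤ) - (c₂ : ℤ) :=
    twelve_sub_degree_eq A₂ t₂ p X hp₂
  rw [hdeg] at hL₁ hL₂
  -- (1) `e₁ ≥ 4`
  have he₁1 : 1 ≤ e₁ := by
    rw [he₁]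
    apply Finset.card_pos.2
    exact ⟨u, mem_filter.2 ⟨hu, hup⟩⟩
  have he₁4 : 4 ≤ e₁ := by
    by_contra hlt
    have h := card_foreign_add_one_le_card_empty_of_le_three A₁ A₂ t₁ t₂ p X hnc hp₁ hsep hfor₁ he₁1
      (by omega)
    have : (c₁ : ℤ) + 1 ≤ e₁ := by exact_mod_cast h
    omega
  -- (2) `e₂ ≥ 1`: the ball below `p` is either on `Λ₂` (then the slot above would be a `Λ₂`-slot, but all
  -- `Λ₂`-slots full contradicts `p + A₁u ∉ X`) or foreign to `Λ₂` (then Rule A gives two empty slots)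
  have hun : ‖A₁ (-u)‖ = 1 := by
    rw [LinearIsometryEquiv.norm_map, norm_neg, norm_eq_one_of_mem_fccSlots hu]
  have hdist_down : dist p (p + A₁ (-u)) = 1 := by
    rw [dist_eq_norm, sub_add_cancel_left, norm_neg, hun]
  have he₂1 : 1 ≤ e₂ := by
    by_contra h0
    have he₂0 : e₂ = 0 := by omega
    have hfull : ∀ w ∈ fccSlots, p + A₂ w ∈ X := by
      intro w hw
      by_contra hwX
      have : 0 < e₂ := by
        rw [he₂]; exact Finset.card_pos.2 ⟨w, mem_filter.2 ⟨hw, hwX⟩⟩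
      omega
    by_cases hb : p + A₁ (-u) ∈ Λ₂
    · -- then `A₁(-u) = A₂ w` for a slot `w`, and `p + A₁ u = p + A₂ (-w)` is a full `Λ₂`-slot
      have hw := symm_sub_mem_fccSlots A₂ t₂ p (p + A₁ (-u)) hp₂ hb hdist_down
      rw [add_sub_cancel_left] at hw
      have hnw := neg_mem_fccSlots hw
      have := hfull _ hnw
      rw [map_neg, LinearIsometryEquiv.apply_symm_apply, map_neg, neg_neg] at this
      exact hup this
    · have h2 := two_le_card_empty_slots_of_foreign A₂ t₂ p (p + A₁ (-u)) X hp₂ hb hdist_down hdown hsep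
      omega
  -- (3) `e₂ ≥ 4`
  have he₂4 : 4 ≤ e₂ := by
    by_contra hlt
    have h := card_foreign_add_one_le_card_empty_of_le_three A₂ A₁ t₂ t₁ p X hnc' hp₂ hsep hfor₂ he₂1
      (by omega)
    have : (c₂ : ℤ) + 1 ≤ e₂ := by exact_mod_cast h
    omega
  -- (4) `e₁ + e₂ ≤ 12`: foreign-to-`Λ₁` neighbours lie on `Λ₂`, hence are NOT foreign to `Λ₂`
  have hc12 : c₁ + c₂ ≤ 12 := by
    have hdisj : Disjoint (X.filter fun q => dist p q = 1 ∧ q ∉ Λ₁) (X.filter fun q => dist p q = 1 ∧ q ∉ Λ₂) := by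
      rw [Finset.disjoint_filter]
      rintro q hq ⟨hd, hn₁⟩ ⟨-, hn₂⟩
      exact hn₂ (hfor₁ q hq hd hn₁)
    have hsub : (X.filter fun q => dist p q = 1 ∧ q ∉ Λ₁) ∪ (X.filter fun q => dist p q = 1 ∧ q ∉ Λ₂) ⊆
        X.filter fun q => dist p q = 1 := by
      intro q hq
      rw [mem_union, mem_filter, mem_filter] at hq
      rw [mem_filter]
      rcases hq with ⟨hqX, hd, -⟩ | ⟨hqX, hd, -⟩ <;> exact ⟨hqX, hd⟩
    have := Finset.card_le_card hsub
    rw [Finset.card_union_of_disjoint hdisj, hdeg] at this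
    exact this
  refine ⟨he₁4, he₂4, ?_⟩
  have : (e₁ : ℤ) + e₂ ≤ 12 := by
    have hc12' : (c₁ : ℤ) + c₂ ≤ 12 := by exact_mod_cast hc12
    omega
  exact_mod_cast this

end Summit.Ventures.Crystal3D.Theorems

end
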